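import Summits.PneNP.PneNP.Theorems.ChebyshevTracialDesignAPrioriBounds
import HarnessLib

/-!
# Cell pnp-psdrank, route `ChebyshevTracialDesign`: psd strategies with FEW DISTINCT CUT MATRICES are rectangles up to
# the number of values (crux `TracialDecayExp20`, stmt-PneNP-19878; eng g10, MEMO-10 §2)

The crux asks for the tracial value `(1/r) Σ_{U,M} W(U,M) tr(X_U Y_M)` of a design weight `W` on tight-orthogonal psd
rectangles of dimension `r`. This file isolates the cheapest structural fact about the DIMENSION side of the problem: if the
cut side takes only finitely many values, `X_U = P_{κ(U)}` for a colouring `κ : OddSet n → ι` and contractions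
`0 ⪯ P_c ⪯ I` (NOT assumed to commute), then for EVERY matching side `0 ⪯ Y_M ⪯ I`

  `Σ_{U,M} W(U,M) tr(P_{κ(U)} Y_M) ≤ r · Σ_{c} Σ_M max(0, Σ_{U : κ(U) = c} W(U,M))`            (`value_le_of_finiteValued`),

i.e. the value PER DIMENSION is at most the sum over the `|ι|` colour classes `X_c = κ⁻¹(c)` of their BEST-RESPONSE RECTANGLE
values `max_B Σ_{X_c × B} W = Σ_M max(0, Σ_{U ∈ X_c} W(U,M))` (`rectangle_le_bestResponse`, `bestResponse_eq_rectangle`); hence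
`≤ r · |ι| · γ` as soon as every 0/1 rectangle has `W`-mass `≤ γ` (`value_le_card_mul_of_rectangleBound`). The proof is one
line of trace inequalities (`0 ≤ tr(P Y) ≤ r` for contractions: `HasPsdFactorization.nonneg` and `…APrioriBounds`), and it does NOT use tightness
(`X_U Y_M = 0` on `cc = 1`): the rectangles on the right are tightness-free.

Reading for the route (eng MEMO-10 §2): the tree's `…Commutative` / `…BlockDiagonal` files reduce COMMUTING strategies to
tight rectangles with no loss; this file says that NON-commuting strategies whose cut side has `L` distinct values gain at most
a factor `L` per dimension over (tightness-free) rectangles — on the symmetry classes where the cell's numerics live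
(`X_U` a function of the level `e(U,M₀)` w.r.t. a planted matching: `L ≤ n/4`; zonal `X_U = P_{|U ∩ B|}`: `L ≤ |B|+1`) a
super-polynomial psd gain is therefore impossible a priori (the measured gain on those classes is reported in eng MEMO-10,
HOME/pnp-psdrank-eng/MEMO-10.md).
Any genuine use of the dimension budget `r < exp(a·dq n/2)` needs cut sides with MANY distinct matrices.
WHAT THIS IS NOT: no statement about general psd rectangles; the right-hand side is the tightness-FREE rectangle value, for
which no decay theorem is in the tree (the `r = 1` rung concerns tight-free rectangles); nothing on psd rank; no P-vs-NP
content. [cite: Rothvoss2017, §2 (PDF pp. 6–8)] [cite: BrietDadushPokutta2014, Thm. 6 (§3)]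
-/

set_option linter.dupNamespace false -- `Summit.PneNP.PneNP.…`: summit = sub-problem (D-0017)

noncomputable section

namespace Summit.PneNP.PneNP.Theorems.ChebyshevTracialDesignFiniteValued

open scoped Classical

open Finset Matrix Literature.Barriers.PneNP Literature.Combinatorics.Optimization
open Summit.PneNP.PneNP.Theorems.ChebyshevTracialDesignAPrioriBounds

variable {n : ℕ}

/-! ### §1 Trace of a product of two contractions lies in `[0, r]` -/

/-- `tr(P Y) ≤ r` for `P ⪯ I` and `0 ⪯ Y ⪯ I` (size `r`). -/
theorem trace_mul_le_card {r : ℕ} {P Y : Matrix (Fin r) (Fin r) ℝ} (h1P : (1 - P).PosSemidef) (hY : Y.PosSemidef)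
    (h1Y : (1 - Y).PosSemidef) : (P * Y).trace ≤ r :=
  (trace_mul_le_trace_right h1P hY).trans (trace_le_of_sub_posSemidef h1Y)

/-- `a · x ≤ max(0, a) · r` for `0 ≤ x ≤ r`. -/
theorem mul_le_max_mul {a x r : ℝ} (hx0 : 0 ≤ x) (hxr : x ≤ r) : a * x ≤ max 0 a * r := by
  by_cases ha : 0 ≤ a
  · rw [max_eq_right ha]; exact mul_le_mul_of_nonneg_left hxr ha
  · have ha' : a < 0 := not_le.1 ha
    rw [max_eq_left ha'.le, zero_mul]; exact mul_nonpos_of_nonpos_of_nonneg ha'.le hx0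

/-! ### §2 Finite-valued cut sides are rectangles up to the number of values -/

/-- **Finite-valued cut sides.** For any weight `W`, any colouring `κ` of the odd cuts by a finite type `ι`, any
contractions `0 ⪯ P_c ⪯ I` (`c : ι`, not necessarily commuting) and ANY contractions `0 ⪯ Y_M ⪯ I`:
`Σ_{U,M} W(U,M) tr(P_{κ(U)} Y_M) ≤ r · Σ_c Σ_M max(0, Σ_{U : κ(U) = c} W(U,M))`. Tightness is not used.
[cite: Rothvoss2017, §2 (PDF pp. 6–8)] -/
theorem value_le_of_finiteValued {r : ℕ} {ι : Type*} [Fintype ι] [DecidableEq ι] (W : OddSet n → PMatch n → ℝ)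
    (κ : OddSet n → ι) (P : ι → Matrix (Fin r) (Fin r) ℝ) (Y : PMatch n → Matrix (Fin r) (Fin r) ℝ)
    (hP : ∀ c, (P c).PosSemidef ∧ (1 - P c).PosSemidef) (hY : ∀ M, (Y M).PosSemidef ∧ (1 - Y M).PosSemidef) :
    ∑ U, ∑ M, W U M * (P (κ U) * Y M).trace ≤
      (r : ℝ) * ∑ c, ∑ M, max 0 (∑ U ∈ univ.filter (fun U => κ U = c), W U M) := by
  -- regroup the cut sum by colour classes
  have hfib : ∀ M, ∑ U, W U M * (P (κ U) * Y M).trace =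
      ∑ c, (∑ U ∈ univ.filter (fun U => κ U = c), W U M) * (P c * Y M).trace := by
    intro M
    rw [← sum_fiberwise_of_maps_to (s := (univ : Finset (OddSet n))) (t := (univ : Finset ι)) (g := κ)
      (fun U _ => mem_univ (κ U))]
    refine sum_congr rfl fun c _ => ?_
    rw [sum_mul]
    refine sum_congr rfl fun U hU => ?_
    rw [(mem_filter.1 hU).2]
  calc ∑ U, ∑ M, W U M * (P (κ U) * Y M).trace
      = ∑ M, ∑ U, W U M * (P (κ U) * Y M).trace := sum_comm
    _ = ∑ M, ∑ c, (∑ U ∈ univ.filter (fun U => κ U = c), W U M) * (P c * Y M).trace :=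
        sum_congr rfl fun M _ => hfib M
    _ ≤ ∑ M, ∑ c, max 0 (∑ U ∈ univ.filter (fun U => κ U = c), W U M) * (r : ℝ) :=
        sum_le_sum fun M _ => sum_le_sum fun c _ =>
          mul_le_max_mul
            -- `0 ≤ tr(P_c Y_M)` for psd `P_c, Y_M`: the tree's `HasPsdFactorization.nonneg` on the `1 × 1` pattern
            ((show HasPsdFactorization (fun (_ : Unit) (_ : Unit) => (P c * Y M).trace) r from
              ⟨fun _ => P c, fun _ => Y M, fun _ => (hP c).1, fun _ => (hY M).1, fun _ _ => rfl⟩).nonneg () ())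
            (trace_mul_le_card (hP c).2 (hY M).1 (hY M).2)
    _ = (r : ℝ) * ∑ c, ∑ M, max 0 (∑ U ∈ univ.filter (fun U => κ U = c), W U M) := by
        rw [sum_comm, mul_sum]
        refine sum_congr rfl fun c _ => ?_
        rw [mul_sum]
        exact sum_congr rfl fun M _ => mul_comm _ _

/-! ### §3 The best-response rectangle of a cut family -/

/-- Every 0/1 rectangle `A × B` has `W`-mass at most the best-response value `Σ_M max(0, Σ_{U ∈ A} W(U,M))` of `A`.
[cite: Rothvoss2017, §2 (PDF pp. 6–8)] -/
theorem rectangle_le_bestResponse (W : OddSet n → PMatch n → ℝ) (A : Finset (OddSet n)) (B : Finset (PMatch n)) :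
    ∑ U ∈ A, ∑ M ∈ B, W U M ≤ ∑ M, max 0 (∑ U ∈ A, W U M) := by
  rw [sum_comm]
  calc ∑ M ∈ B, ∑ U ∈ A, W U M ≤ ∑ M ∈ B, max 0 (∑ U ∈ A, W U M) := sum_le_sum fun M _ => le_max_right _ _
    _ ≤ ∑ M, max 0 (∑ U ∈ A, W U M) :=
        sum_le_sum_of_subset_of_nonneg (subset_univ B) fun M _ _ => le_max_left _ _

/-- The best-response value of `A` IS the `W`-mass of the rectangle `A × B⁺(A)`, `B⁺(A) = {M : Σ_{U ∈ A} W(U,M) > 0}`.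
[cite: Rothvoss2017, §2 (PDF pp. 6–8)] -/
theorem bestResponse_eq_rectangle (W : OddSet n → PMatch n → ℝ) (A : Finset (OddSet n)) :
    ∑ M, max 0 (∑ U ∈ A, W U M) =
      ∑ U ∈ A, ∑ M ∈ univ.filter (fun M => 0 < ∑ U ∈ A, W U M), W U M := by
  rw [sum_comm, sum_filter]
  refine sum_congr rfl fun M _ => ?_
  split_ifs with h
  · exact max_eq_right h.le
  · exact max_eq_left (not_lt.1 h)

/-- **Packaged form.** If EVERY 0/1 rectangle has `W`-mass `≤ γ` (no tightness hypothesis), then every psd strategy whose cut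
side takes at most `|ι|` distinct values has `Σ_{U,M} W tr(X_U Y_M) ≤ r · |ι| · γ` against every contraction-valued matching
side — per dimension, at most `|ι|` times the rectangle bound. [cite: Rothvoss2017, §2 (PDF pp. 6–8)]
[cite: BrietDadushPokutta2014, Thm. 6 (§3)] -/
theorem value_le_card_mul_of_rectangleBound {r : ℕ} {ι : Type*} [Fintype ι] [DecidableEq ι]
    (W : OddSet n → PMatch n → ℝ) {γ : ℝ}
    (hrect : ∀ (A : Finset (OddSet n)) (B : Finset (PMatch n)), ∑ U ∈ A, ∑ M ∈ B, W U M ≤ γ)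
    (κ : OddSet n → ι) (P : ι → Matrix (Fin r) (Fin r) ℝ) (Y : PMatch n → Matrix (Fin r) (Fin r) ℝ)
    (hP : ∀ c, (P c).PosSemidef ∧ (1 - P c).PosSemidef) (hY : ∀ M, (Y M).PosSemidef ∧ (1 - Y M).PosSemidef) :
    ∑ U, ∑ M, W U M * (P (κ U) * Y M).trace ≤ (r : ℝ) * (Fintype.card ι * γ) := by
  refine (value_le_of_finiteValued W κ P Y hP hY).trans (mul_le_mul_of_nonneg_left ?_ (Nat.cast_nonneg r))
  calc ∑ c, ∑ M, max 0 (∑ U ∈ univ.filter (fun U => κ U = c), W U M)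
      ≤ ∑ _c : ι, γ := sum_le_sum fun c _ => by
          rw [bestResponse_eq_rectangle]
          exact hrect _ _
    _ = Fintype.card ι * γ := by rw [sum_const, card_univ, nsmul_eq_mul]

/-- **In the crux's currency.** For a tight-orthogonal psd rectangle `(X, Y)` of dimension `r ≥ 1` (`IsPsdRect`) whose cut side is
finite-valued, `X = P ∘ κ` for a colouring `κ` by a finite type `ι`, and a weight all of whose 0/1 rectangles have mass `≤ γ`:
the normalised value is `≤ |ι| · γ`. [cite: Rothvoss2017, §2 (PDF pp. 6–8)] [cite: GriblingDelaatLaurent2019, §5] -/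
theorem value_div_le_of_finiteValued {r : ℕ} (hr : 0 < r) {ι : Type*} [Fintype ι] [DecidableEq ι]
    (W : OddSet n → PMatch n → ℝ) {γ : ℝ}
    (hrect : ∀ (A : Finset (OddSet n)) (B : Finset (PMatch n)), ∑ U ∈ A, ∑ M ∈ B, W U M ≤ γ)
    (κ : OddSet n → ι) (P : ι → Matrix (Fin r) (Fin r) ℝ) {X : OddSet n → Matrix (Fin r) (Fin r) ℝ}
    {Y : PMatch n → Matrix (Fin r) (Fin r) ℝ} (hXY : IsPsdRect X Y) (hX : ∀ U, X U = P (κ U)) :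
    (∑ U, ∑ M, W U M * (X U * Y M).trace) / r ≤ Fintype.card ι * γ := by
  have hr' : (0 : ℝ) < r := by exact_mod_cast hr
  -- palette restricted to the colours actually used (unused colours get the contraction `0`)
  set P' : ι → Matrix (Fin r) (Fin r) ℝ := fun c => if ∃ U, κ U = c then P c else 0 with hP'def
  have hXP' : ∀ U, X U = P' (κ U) := fun U => by rw [hP'def]; dsimp only; rw [if_pos ⟨U, rfl⟩]; exact hX U
  have hP' : ∀ c, (P' c).PosSemidef ∧ (1 - P' c).PosSemidef := by
    intro c
    by_cases hc : ∃ U, κ U = c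
    · obtain ⟨U, rfl⟩ := hc
      rw [← hXP' U]
      exact hXY.1 U
    · rw [hP'def]; dsimp only; rw [if_neg hc, sub_zero]
      exact ⟨Matrix.PosSemidef.zero, Matrix.PosSemidef.one⟩
  have h := value_le_card_mul_of_rectangleBound W hrect κ P' Y hP' (fun M => hXY.2.1 M)
  have hrw : ∑ U, ∑ M, W U M * (X U * Y M).trace = ∑ U, ∑ M, W U M * (P' (κ U) * Y M).trace :=
    sum_congr rfl fun U _ => by rw [hXP' U]
  rw [hrw, div_le_iff₀ hr']
  calc ∑ U, ∑ M, W U M * (P' (κ U) * Y M).trace ≤ (r : ℝ) * (Fintype.card ι * γ) := h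
    _ = Fintype.card ι * γ * r := by ring


/-! ### §4 The matching-side twin (appended, eng g10)

The same bookkeeping with the roles of the two sides exchanged: a psd strategy whose MATCHING side takes finitely many values,
`Y_M = Q_{κ'(M)}`, is worth per dimension at most the sum over its matching classes `B_c = κ'⁻¹(c)` of their best-response rectangle
values `Σ_U max(0, Σ_{M ∈ B_c} W(U,M)) = max_A Σ_{A × B_c} W`, for EVERY contraction-valued cut side. [cite: Rothvoss2017, §2 (PDF pp. 6–8)] -/

/-- **Finite-valued matching sides.** For any weight `W`, any colouring `κ'` of the perfect matchings by a finite type `ι`, any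
contractions `0 ⪯ Q_c ⪯ I` and ANY contractions `0 ⪯ X_U ⪯ I`:
`Σ_{U,M} W(U,M) tr(X_U Q_{κ'(M)}) ≤ r · Σ_c Σ_U max(0, Σ_{M : κ'(M) = c} W(U,M))`. Tightness is not used.
[cite: Rothvoss2017, §2 (PDF pp. 6–8)] -/
theorem value_le_of_finiteValued_right {r : ℕ} {ι : Type*} [Fintype ι] [DecidableEq ι] (W : OddSet n → PMatch n → ℝ)
    (κ' : PMatch n → ι) (X : OddSet n → Matrix (Fin r) (Fin r) ℝ) (Q : ι → Matrix (Fin r) (Fin r) ℝ)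
    (hX : ∀ U, (X U).PosSemidef ∧ (1 - X U).PosSemidef) (hQ : ∀ c, (Q c).PosSemidef ∧ (1 - Q c).PosSemidef) :
    ∑ U, ∑ M, W U M * (X U * Q (κ' M)).trace ≤
      (r : ℝ) * ∑ c, ∑ U, max 0 (∑ M ∈ univ.filter (fun M => κ' M = c), W U M) := by
  have hfib : ∀ U, ∑ M, W U M * (X U * Q (κ' M)).trace =
      ∑ c, (∑ M ∈ univ.filter (fun M => κ' M = c), W U M) * (X U * Q c).trace := by
    intro U
    rw [← sum_fiberwise_of_maps_to (s := (univ : Finset (PMatch n))) (t := (univ : Finset ι)) (g := κ')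
      (fun M _ => mem_univ (κ' M))]
    refine sum_congr rfl fun c _ => ?_
    rw [sum_mul]
    refine sum_congr rfl fun M hM => ?_
    rw [(mem_filter.1 hM).2]
  calc ∑ U, ∑ M, W U M * (X U * Q (κ' M)).trace
      = ∑ U, ∑ c, (∑ M ∈ univ.filter (fun M => κ' M = c), W U M) * (X U * Q c).trace :=
        sum_congr rfl fun U _ => hfib U
    _ ≤ ∑ U, ∑ c, max 0 (∑ M ∈ univ.filter (fun M => κ' M = c), W U M) * (r : ℝ) :=
        sum_le_sum fun U _ => sum_le_sum fun c _ =>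
          mul_le_max_mul
            ((show HasPsdFactorization (fun (_ : Unit) (_ : Unit) => (X U * Q c).trace) r from
              ⟨fun _ => X U, fun _ => Q c, fun _ => (hX U).1, fun _ => (hQ c).1, fun _ _ => rfl⟩).nonneg () ())
            (trace_mul_le_card (hX U).2 (hQ c).1 (hQ c).2)
    _ = (r : ℝ) * ∑ c, ∑ U, max 0 (∑ M ∈ univ.filter (fun M => κ' M = c), W U M) := by
        rw [sum_comm, mul_sum]
        refine sum_congr rfl fun c _ => ?_
        rw [mul_sum]
        exact sum_congr rfl fun U _ => mul_comm _ _

/-- The matching-side best-response value of a class `B` dominates every rectangle `A × B`. [cite: Rothvoss2017, §2 (PDF pp. 6–8)] -/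
theorem rectangle_le_bestResponse_right (W : OddSet n → PMatch n → ℝ) (A : Finset (OddSet n)) (B : Finset (PMatch n)) :
    ∑ U ∈ A, ∑ M ∈ B, W U M ≤ ∑ U, max 0 (∑ M ∈ B, W U M) :=
  calc ∑ U ∈ A, ∑ M ∈ B, W U M ≤ ∑ U ∈ A, max 0 (∑ M ∈ B, W U M) := sum_le_sum fun _ _ => le_max_right _ _
    _ ≤ ∑ U, max 0 (∑ M ∈ B, W U M) :=
        sum_le_sum_of_subset_of_nonneg (subset_univ A) fun _ _ _ => le_max_left _ _

/-- **Packaged twin.** If every 0/1 rectangle has `W`-mass `≤ γ`, a psd strategy whose matching side takes at most `|ι|` values has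
`Σ W tr(X_U Y_M) ≤ r · |ι| · γ` against every contraction-valued cut side. [cite: Rothvoss2017, §2 (PDF pp. 6–8)]
[cite: BrietDadushPokutta2014, Thm. 6 (§3)] -/
theorem value_le_card_mul_of_rectangleBound_right {r : ℕ} {ι : Type*} [Fintype ι] [DecidableEq ι]
    (W : OddSet n → PMatch n → ℝ) {γ : ℝ}
    (hrect : ∀ (A : Finset (OddSet n)) (B : Finset (PMatch n)), ∑ U ∈ A, ∑ M ∈ B, W U M ≤ γ)
    (κ' : PMatch n → ι) (X : OddSet n → Matrix (Fin r) (Fin r) ℝ) (Q : ι → Matrix (Fin r) (Fin r) ℝ)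
    (hX : ∀ U, (X U).PosSemidef ∧ (1 - X U).PosSemidef) (hQ : ∀ c, (Q c).PosSemidef ∧ (1 - Q c).PosSemidef) :
    ∑ U, ∑ M, W U M * (X U * Q (κ' M)).trace ≤ (r : ℝ) * (Fintype.card ι * γ) := by
  refine (value_le_of_finiteValued_right W κ' X Q hX hQ).trans (mul_le_mul_of_nonneg_left ?_ (Nat.cast_nonneg r))
  calc ∑ c, ∑ U, max 0 (∑ M ∈ univ.filter (fun M => κ' M = c), W U M)
      ≤ ∑ _c : ι, γ := sum_le_sum fun c _ => by
          -- the best response of the class is the rectangle `A⁺ × B_c`, `A⁺ = {U : column sum > 0}`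
          have h : ∑ U, max 0 (∑ M ∈ univ.filter (fun M => κ' M = c), W U M) =
              ∑ U ∈ univ.filter (fun U => 0 < ∑ M ∈ univ.filter (fun M => κ' M = c), W U M),
                ∑ M ∈ univ.filter (fun M => κ' M = c), W U M := by
            rw [sum_filter]
            refine sum_congr rfl fun U _ => ?_
            split_ifs with hU
            · exact max_eq_right hU.le
            · exact max_eq_left (not_lt.1 hU)
          rw [h]
          exact hrect _ _
    _ = Fintype.card ι * γ := by rw [sum_const, card_univ, nsmul_eq_mul]

end Summit.PneNP.PneNP.Theorems.ChebyshevTracialDesignFiniteValued
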